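import Summits.NavierStokesRegularity.NavierStokesRegularity.Theorems.AxisTwistDoorAveragedConeLiouvilleNUDefs
import Summits.NavierStokesRegularity.NavierStokesRegularity.Theorems.AxisTwistDoorAveragedConeLiouvilleDefs
import HarnessLib

/-!
# Nazarov–Uraltseva 2011, Cor. 3.2 (propagation of positivity, N4 of cell pub/ns-inputs), piece P5 (assembly),
# brick T: CHAINING SHORT CYLINDERS IN TIME — `PositivityPropagationFactC` for all cylinder lengths `T` from the
# same statement for `T ≤ T⋆`

The De Giorgi–Moser frames of the axis-free chain (`NUStanding`, piece W′) have time-length `R² < 1/4`, so the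
one-frame argument (N–U 2011 Cor. 3.2 (1)–(2), Lemma 3.4) yields the classical closed-cylinder positivity
propagation `PositivityPropagationFactC` (`…AveragedConeLiouvilleDefs`) only for SHORT cylinders `T ≤ T⋆`.  This
file removes that restriction by pure bookkeeping (no PDE): for `T > T⋆` put `L = min T⋆ (T/5)` and run the short
statement on the half/quarter-overlapping windows `(a_j, a_j + L)`, `a_j = a₀ + jL/4`, `a₀ = max 0 (t̄ − L/4)`, of the
TIME-TRANSLATED data `V(· + a_j, ·)` (again classical data on `(0, L) × B(0,1)`): window `0` uses the given density at
`t̄`, window `j+1` uses the full lower bound of window `j` on `B(0,r)` at the time `a_j + 13L/24` (density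
`vol B(0,r) = (4π/3) r³`), and a last window `(T − L, T)` reaches the top; at most `⌊4T/L⌋ + 2` factors `β ≤ 1` are
lost, all depending on `(δ, T, r, Λ)` only.

* `factC_of_factC_short` — `(∀ δ T r Λ, … → T ≤ T⋆ → … ∃ β …) → PositivityPropagationFactC`.

Width seat ns-in-wu-341 g2 (director-ns inputs-23 and inputs-26; plan g6 N4 cut, piece P5 architecture posted on
pub/ns-inputs/STATUS 12:3xZ). [cite: NazarovUraltseva2011HarnackDivFree, §3 Cor. 3.2, Lemma 3.4; LeiRenTian2025, Lemma 2.5]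

WHAT THIS IS NOT: not a statement about Navier–Stokes regularity; bookkeeping toward the discharge of the NAMED fact
`NazarovUraltseva2011_positivity_propagation` (INPUT N4); nothing is closed by this file.
-/

noncomputable section

-- the summit and its single sub-problem share the name (CONVENTIONS §1)
set_option linter.dupNamespace false

namespace Summit.NavierStokesRegularity.NavierStokesRegularity.Theorems.AveragedConeLiouville.NU

open scoped InnerProductSpace Laplacian ENNReal
open Set Metric MeasureTheory Function
open Literature.Analysis.FluidPDE
open Summit.NavierStokesRegularity.NavierStokesRegularity.Theorems.AxisTwistDoorAveragedConeLiouvilleDefs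

/-- **`PositivityPropagationFactC` from its restriction to short cylinders `T ≤ T⋆`** (module docstring).
[cite: NazarovUraltseva2011HarnackDivFree, §3 Cor. 3.2, Lemma 3.4] -/
theorem factC_of_factC_short {Tstar : ℝ} (hTstar : 0 < Tstar)
    (hK : ∀ δ T r Λ : ℝ, 0 < δ → 0 < T → T ≤ Tstar → 0 < r → r < 1 → 0 ≤ Λ → ∃ β : ℝ, 0 < β ∧
      ∀ (V : ℝ → EuclideanSpace ℝ (Fin 3) → ℝ) (b : ℝ → EuclideanSpace ℝ (Fin 3) → EuclideanSpace ℝ (Fin 3))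
        (U : Set (ℝ × EuclideanSpace ℝ (Fin 3))), IsOpen U →
        Set.Icc 0 T ×ˢ Metric.closedBall (0 : EuclideanSpace ℝ (Fin 3)) 1 ⊆ U →
        ContDiffOn ℝ 2 (Function.uncurry V) U → ContDiffOn ℝ 1 (Function.uncurry b) U →
        (∀ t ∈ Set.Ioo 0 T, ∀ x ∈ Metric.ball (0 : EuclideanSpace ℝ (Fin 3)) 1, ‖b t x‖ ≤ Λ) →
        (∀ t ∈ Set.Ioo 0 T, ∀ x ∈ Metric.ball (0 : EuclideanSpace ℝ (Fin 3)) 1,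
            VectorCalculus.divergence (b t) x = 0) →
        (∀ t ∈ Set.Ioo 0 T, ∀ x ∈ Metric.ball (0 : EuclideanSpace ℝ (Fin 3)) 1, 0 ≤ V t x) →
        (∀ t ∈ Set.Ioo 0 T, ∀ x ∈ Metric.ball (0 : EuclideanSpace ℝ (Fin 3)) 1,
            0 ≤ deriv (fun τ => V τ x) t - (Δ (V t)) x + ⟪b t x, gradient (V t) x⟫_ℝ) →
        ∀ tbar lam : ℝ, 0 < tbar → tbar < T / 3 → 0 < lam →
          ENNReal.ofReal δ ≤ volume {x : EuclideanSpace ℝ (Fin 3) |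
              x ∈ Metric.ball (0 : EuclideanSpace ℝ (Fin 3)) 1 ∧ lam ≤ V tbar x} →
          ∀ t ∈ Set.Ioo (T / 2) T, ∀ x ∈ Metric.ball (0 : EuclideanSpace ℝ (Fin 3)) r, β * lam ≤ V t x) :
    PositivityPropagationFactC := by
  intro δ T r Λ hδ hT hr hr1 hΛ
  by_cases hTs : T ≤ Tstar
  · exact hK δ T r Λ hδ hT hTs hr hr1 hΛ
  push Not at hTs
  -- ### window length and the two kernels
  set L : ℝ := min Tstar (T / 5) with hLdef
  have hL0 : 0 < L := lt_min hTstar (by linarith)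
  have hLs : L ≤ Tstar := min_le_left _ _
  have hL4 : L ≤ T / 5 := min_le_right _ _
  obtain ⟨β₀, hβ₀, K₀⟩ := hK δ L r Λ hδ hL0 hLs hr hr1 hΛ
  set δ₁ : ℝ := r ^ 3 * (Real.pi * 4 / 3) with hδ₁
  have hδ₁0 : 0 < δ₁ := by positivity
  obtain ⟨β₁, hβ₁, K₁⟩ := hK δ₁ L r Λ hδ₁0 hL0 hLs hr hr1 hΛ
  have hb0 : 0 < min β₀ 1 := lt_min hβ₀ one_pos
  have hb1 : 0 < min β₁ 1 := lt_min hβ₁ one_pos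
  have hb0le : min β₀ 1 ≤ β₀ := min_le_left _ _
  have hb1le : min β₁ 1 ≤ β₁ := min_le_left _ _
  have hb1one : min β₁ 1 ≤ 1 := min_le_right _ _
  obtain ⟨Nmax, hNmax⟩ : ∃ Nmax : ℕ, 4 * T / L + 1 ≤ Nmax := exists_nat_ge _
  refine ⟨min β₀ 1 * (min β₁ 1) ^ (Nmax + 1), by positivity, ?_⟩
  intro V b U hU hcylU hV hb hbd hdiv hV0 hsup tbar lam htbar htbar3 hlam hdens t ht x hx
  -- ### time-translated data on a window `(a, a + L) ⊆ (0, T)` satisfy the kernel hypotheses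
  have hwindow : ∀ (a : ℝ), 0 ≤ a → a + L ≤ T →
      ∀ (δ' β' : ℝ),
      (∀ (V' : ℝ → EuclideanSpace ℝ (Fin 3) → ℝ) (b' : ℝ → EuclideanSpace ℝ (Fin 3) → EuclideanSpace ℝ (Fin 3))
        (U' : Set (ℝ × EuclideanSpace ℝ (Fin 3))), IsOpen U' →
        Set.Icc 0 L ×ˢ Metric.closedBall (0 : EuclideanSpace ℝ (Fin 3)) 1 ⊆ U' →
        ContDiffOn ℝ 2 (Function.uncurry V') U' → ContDiffOn ℝ 1 (Function.uncurry b') U' →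
        (∀ t ∈ Set.Ioo 0 L, ∀ x ∈ Metric.ball (0 : EuclideanSpace ℝ (Fin 3)) 1, ‖b' t x‖ ≤ Λ) →
        (∀ t ∈ Set.Ioo 0 L, ∀ x ∈ Metric.ball (0 : EuclideanSpace ℝ (Fin 3)) 1,
            VectorCalculus.divergence (b' t) x = 0) →
        (∀ t ∈ Set.Ioo 0 L, ∀ x ∈ Metric.ball (0 : EuclideanSpace ℝ (Fin 3)) 1, 0 ≤ V' t x) →
        (∀ t ∈ Set.Ioo 0 L, ∀ x ∈ Metric.ball (0 : EuclideanSpace ℝ (Fin 3)) 1,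
            0 ≤ deriv (fun τ => V' τ x) t - (Δ (V' t)) x + ⟪b' t x, gradient (V' t) x⟫_ℝ) →
        ∀ tbar lam : ℝ, 0 < tbar → tbar < L / 3 → 0 < lam →
          ENNReal.ofReal δ' ≤ volume {x : EuclideanSpace ℝ (Fin 3) |
              x ∈ Metric.ball (0 : EuclideanSpace ℝ (Fin 3)) 1 ∧ lam ≤ V' tbar x} →
          ∀ t ∈ Set.Ioo (L / 2) L, ∀ x ∈ Metric.ball (0 : EuclideanSpace ℝ (Fin 3)) r, β' * lam ≤ V' t x) →
      ∀ (tb c : ℝ), a < tb → tb < a + L / 3 → 0 < c →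
        ENNReal.ofReal δ' ≤ volume {y : EuclideanSpace ℝ (Fin 3) |
            y ∈ Metric.ball (0 : EuclideanSpace ℝ (Fin 3)) 1 ∧ c ≤ V tb y} →
        ∀ s ∈ Set.Ioo (a + L / 2) (a + L), ∀ y ∈ Metric.ball (0 : EuclideanSpace ℝ (Fin 3)) r,
          β' * c ≤ V s y := by
    intro a ha haL δ' β' K tb c htb1 htb2 hc hden s hs y hy
    -- the translated data
    have hUa : IsOpen ((fun p : ℝ × EuclideanSpace ℝ (Fin 3) => (p.1 + a, p.2)) ⁻¹' U) :=
      hU.preimage (by fun_prop)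
    have hcyla : Set.Icc 0 L ×ˢ Metric.closedBall (0 : EuclideanSpace ℝ (Fin 3)) 1 ⊆
        (fun p : ℝ × EuclideanSpace ℝ (Fin 3) => (p.1 + a, p.2)) ⁻¹' U := by
      intro p hp
      refine hcylU ⟨⟨?_, ?_⟩, hp.2⟩
      · have := hp.1.1; simp only at this ⊢; linarith
      · have := hp.1.2; simp only at this ⊢; linarith
    have hVa : ContDiffOn ℝ 2 (Function.uncurry fun s z => V (s + a) z)
        ((fun p : ℝ × EuclideanSpace ℝ (Fin 3) => (p.1 + a, p.2)) ⁻¹' U) := by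
      have heq : (Function.uncurry fun s z => V (s + a) z) =
          Function.uncurry V ∘ (fun p : ℝ × EuclideanSpace ℝ (Fin 3) => (p.1 + a, p.2)) := by
        funext p; rfl
      rw [heq]
      exact hV.comp (by fun_prop) (fun p hp => hp)
    have hba : ContDiffOn ℝ 1 (Function.uncurry fun s z => b (s + a) z)
        ((fun p : ℝ × EuclideanSpace ℝ (Fin 3) => (p.1 + a, p.2)) ⁻¹' U) := by
      have heq : (Function.uncurry fun s z => b (s + a) z) =
          Function.uncurry b ∘ (fun p : ℝ × EuclideanSpace ℝ (Fin 3) => (p.1 + a, p.2)) := by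
        funext p; rfl
      rw [heq]
      exact hb.comp (by fun_prop) (fun p hp => hp)
    have hshift : ∀ s' ∈ Set.Ioo 0 L, s' + a ∈ Set.Ioo 0 T := fun s' hs' =>
      ⟨by linarith [hs'.1], by linarith [hs'.2]⟩
    have h := K (fun s z => V (s + a) z) (fun s z => b (s + a) z) _ hUa hcyla hVa hba
      (fun s' hs' z hz => hbd (s' + a) (hshift s' hs') z hz)
      (fun s' hs' z hz => hdiv (s' + a) (hshift s' hs') z hz)
      (fun s' hs' z hz => hV0 (s' + a) (hshift s' hs') z hz)
      (fun s' hs' z hz => by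
        have h1 := hsup (s' + a) (hshift s' hs') z hz
        have h2 : deriv (fun τ => V (τ + a) z) s' = deriv (fun τ => V τ z) (s' + a) :=
          deriv_comp_add_const (fun τ => V τ z) a s'
        rw [h2]; exact h1)
      (tb - a) c (by linarith) (by linarith) hc (by simpa using hden) (s - a) ⟨by linarith [hs.1], by linarith [hs.2]⟩ y hy
    simpa using h
  -- ### the chain of windows `a_j = a₀ + j L/4`
  set a₀ : ℝ := max 0 (tbar - L / 4) with ha₀
  have ha₀0 : 0 ≤ a₀ := le_max_left _ _
  have ha₀1 : a₀ < tbar := max_lt htbar (by linarith)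
  have ha₀2 : tbar < a₀ + L / 3 := by
    rcases le_total 0 (tbar - L / 4) with h | h
    · rw [ha₀, max_eq_right h]; linarith
    · rw [ha₀, max_eq_left h]; linarith
  have ha₀3 : a₀ ≤ tbar := ha₀1.le
  have hchain : ∀ j : ℕ, a₀ + j * (L / 4) + L ≤ T →
      ∀ s ∈ Set.Ioo (a₀ + j * (L / 4) + L / 2) (a₀ + j * (L / 4) + L),
        ∀ y ∈ Metric.ball (0 : EuclideanSpace ℝ (Fin 3)) r, min β₀ 1 * (min β₁ 1) ^ j * lam ≤ V s y := by
    intro j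
    induction j with
    | zero =>
      intro hj s hs y hy
      simp only [Nat.cast_zero, zero_mul, add_zero, pow_zero, mul_one] at hj hs ⊢
      have h := hwindow a₀ ha₀0 hj δ β₀ K₀ tbar lam ha₀1 ha₀2 hlam hdens s hs y hy
      exact le_trans (mul_le_mul_of_nonneg_right hb0le hlam.le) h
    | succ j ih =>
      intro hj s hs y hy
      have hj' : a₀ + j * (L / 4) + L ≤ T := by push_cast at hj; linarith
      -- the intermediate time `tb = a_j + 13L/24`
      set tb : ℝ := a₀ + j * (L / 4) + 13 * L / 24 with htb
      have hprev : ∀ y ∈ Metric.ball (0 : EuclideanSpace ℝ (Fin 3)) r,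
          min β₀ 1 * (min β₁ 1) ^ j * lam ≤ V tb y :=
        fun y hy => ih hj' tb ⟨by rw [htb]; linarith, by rw [htb]; linarith⟩ y hy
      have hcpos : 0 < min β₀ 1 * (min β₁ 1) ^ j * lam := by positivity
      have hden1 : ENNReal.ofReal δ₁ ≤ volume {y : EuclideanSpace ℝ (Fin 3) |
          y ∈ Metric.ball (0 : EuclideanSpace ℝ (Fin 3)) 1 ∧ min β₀ 1 * (min β₁ 1) ^ j * lam ≤ V tb y} := by
        have hvol : volume (Metric.ball (0 : EuclideanSpace ℝ (Fin 3)) r) = ENNReal.ofReal δ₁ := by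
          rw [EuclideanSpace.volume_ball_fin_three, hδ₁, ← ENNReal.ofReal_pow hr.le,
            ← ENNReal.ofReal_mul (by positivity)]
        rw [← hvol]
        exact measure_mono fun y hy => ⟨Metric.ball_subset_ball hr1.le hy, hprev y hy⟩
      have h := hwindow (a₀ + ((j + 1 : ℕ) : ℝ) * (L / 4)) (by positivity) hj δ₁ β₁ K₁ tb
        (min β₀ 1 * (min β₁ 1) ^ j * lam) (by rw [htb]; push_cast; linarith)
        (by rw [htb]; push_cast; linarith) hcpos hden1 s hs y hy
      calc min β₀ 1 * (min β₁ 1) ^ (j + 1) * lam = min β₁ 1 * (min β₀ 1 * (min β₁ 1) ^ j * lam) := by ring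
        _ ≤ β₁ * (min β₀ 1 * (min β₁ 1) ^ j * lam) := mul_le_mul_of_nonneg_right hb1le hcpos.le
        _ ≤ V s y := h
  -- ### every time in `(T/2, T − L/2]` is covered by a window with index `≤ Nmax`
  have hcover : ∀ s : ℝ, T / 2 < s → s ≤ T - L / 2 →
      ∀ y ∈ Metric.ball (0 : EuclideanSpace ℝ (Fin 3)) r, min β₀ 1 * (min β₁ 1) ^ Nmax * lam ≤ V s y := by
    intro s hs1 hs2 y hy
    obtain ⟨j, hj1, hj2⟩ : ∃ j : ℕ, (s - a₀ - 3 * L / 4) / (L / 4) ≤ j ∧ (j : ℝ) < (s - a₀ - 3 * L / 4) / (L / 4) + 1 :=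
      ⟨⌈(s - a₀ - 3 * L / 4) / (L / 4)⌉₊, Nat.le_ceil _, by
        have := Nat.ceil_lt_add_one (show 0 ≤ (s - a₀ - 3 * L / 4) / (L / 4) by
          apply div_nonneg _ (by positivity); linarith)
        exact_mod_cast this⟩
    have hL4pos : 0 < L / 4 := by positivity
    have hj1' : s - a₀ - 3 * L / 4 ≤ j * (L / 4) := by rwa [div_le_iff₀ hL4pos] at hj1
    have hj2' : (j : ℝ) * (L / 4) < s - a₀ - 3 * L / 4 + L / 4 := by
      have h := mul_lt_mul_of_pos_right hj2 hL4pos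
      rwa [add_mul, div_mul_cancel₀ _ hL4pos.ne', one_mul] at h
    have hwin : s ∈ Set.Ioo (a₀ + j * (L / 4) + L / 2) (a₀ + j * (L / 4) + L) := ⟨by linarith, by linarith⟩
    have hjT : a₀ + j * (L / 4) + L ≤ T := by linarith
    have hjN : j ≤ Nmax := by
      have h1 : (j : ℝ) ≤ 4 * T / L + 1 := by
        have h2 : (s - a₀ - 3 * L / 4) / (L / 4) ≤ 4 * T / L := by
          rw [div_le_iff₀ hL4pos, show 4 * T / L * (L / 4) = T by field_simp]; linarith
        linarith
      exact_mod_cast h1.trans hNmax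
    have h := hchain j hjT s hwin y hy
    have hpow : (min β₁ 1) ^ Nmax ≤ (min β₁ 1) ^ j := pow_le_pow_of_le_one hb1.le hb1one hjN
    calc min β₀ 1 * (min β₁ 1) ^ Nmax * lam ≤ min β₀ 1 * (min β₁ 1) ^ j * lam := by gcongr
      _ ≤ V s y := h
  -- ### the target time: regular window, or the last window `(T − L, T)`
  have hβpow : min β₀ 1 * (min β₁ 1) ^ (Nmax + 1) * lam ≤ min β₀ 1 * (min β₁ 1) ^ Nmax * lam := by
    have : (min β₁ 1) ^ (Nmax + 1) ≤ (min β₁ 1) ^ Nmax := pow_le_pow_of_le_one hb1.le hb1one (Nat.le_succ _)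
    gcongr
  by_cases hlast : t ≤ T - L / 2
  · exact hβpow.trans (hcover t ht.1 hlast x hx)
  · push Not at hlast
    -- the last window, fed by the regular cover at `tb = T − 3L/4`
    have hcpos : 0 < min β₀ 1 * (min β₁ 1) ^ Nmax * lam := by positivity
    have hden1 : ENNReal.ofReal δ₁ ≤ volume {y : EuclideanSpace ℝ (Fin 3) |
        y ∈ Metric.ball (0 : EuclideanSpace ℝ (Fin 3)) 1 ∧ min β₀ 1 * (min β₁ 1) ^ Nmax * lam ≤ V (T - 3 * L / 4) y} := by
      have hvol : volume (Metric.ball (0 : EuclideanSpace ℝ (Fin 3)) r) = ENNReal.ofReal δ₁ := by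
        rw [EuclideanSpace.volume_ball_fin_three, hδ₁, ← ENNReal.ofReal_pow hr.le,
          ← ENNReal.ofReal_mul (by positivity)]
      rw [← hvol]
      exact measure_mono fun y hy =>
        ⟨Metric.ball_subset_ball hr1.le hy, hcover (T - 3 * L / 4) (by linarith) (by linarith) y hy⟩
    have h := hwindow (T - L) (by linarith) (by linarith) δ₁ β₁ K₁ (T - 3 * L / 4)
      (min β₀ 1 * (min β₁ 1) ^ Nmax * lam) (by linarith) (by linarith) hcpos hden1 t
      ⟨by linarith, by linarith [ht.2]⟩ x hx
    calc min β₀ 1 * (min β₁ 1) ^ (Nmax + 1) * lam = min β₁ 1 * (min β₀ 1 * (min β₁ 1) ^ Nmax * lam) := by ring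
      _ ≤ β₁ * (min β₀ 1 * (min β₁ 1) ^ Nmax * lam) := mul_le_mul_of_nonneg_right hb1le hcpos.le
      _ ≤ V t x := h

end Summit.NavierStokesRegularity.NavierStokesRegularity.Theorems.AveragedConeLiouville.NU

end
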